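/-
Origin: expansion seat `prover-pub-hodgecm-mc-binder-2-g14-0`, handover #N3 2026-08-20T11:00Z md5 19e2fff8557f (NEW 19e2fff8557f; 251 l.; imports N2; `span_tprod_of_forall_span_eq_top`, `ωT_tprod_locFam`, `span_tprod_locFam`, `omgW_ins_tprod_famOf_wmInputCM₂g` (Weil side on pure tensors, OmgInsTorus), `scalar_eq_of_weight`, **`omgW_ins_eq_of_weight`** = E row-18 family `homg` (∀ f t φ) at the W pin `wmInputCM₂g … ι₁ V.sylvesterFrame …` as a THEOREM modulo the (J-μ) scalar identity `hμ` (same hypothesis as #39); NAME LIST: HodgeCM.Model.HypCensus.omgW_ins_eq_of_weight · HodgeCM.Model.HypCensus.scalar_eq_of_weight · HodgeCM.Model.HypCensus.omgW_ins_tprod_famOf_wmInputCM₂g) (`HOME/mc/pub-hodgecm-mc-binder-2/g14/t12/HodgeCM/Model/HypCensus/OmgInsAll.lean`, md5 19e2fff8557f, 251 lines);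
landed by the second packager p2 gen 7 (p2-g7) in gate run 50 as `HodgeCM/Model/HypCensus/OmgInsAll.lean` (verbatim).
-/
/-
Copyright (c) 2026. All rights reserved.
Released under Apache 2.0 license as described in the file LICENSE.
-/
import Summits.HodgeConjecture.HodgeCM.Model.HypCensus.OmgInsLetters_2

/-!
# Census kit (rows 17/18/19), (T12): the torus junction `omg_ins` for EVERY printed vector, modulo (J-μ)

Assembly of `OmgInsLetters`: with the orientation-aware census (`PlaceChoice.datumAt`, RULING S5 (B1)), the single scalar identity
(J-μ) `hμ` on the torus — the hypothesis of the vacuum junction `OmgInsPinChoice.omgW_ins_vacuum_datumAt_eq_of_weight` — gives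
`ω(ι_T t)(ins f φ) = ins f (ω_T(t) φ)` for every `φ ∈ 𝓕_print`:

* §1 pure tensors of spanning families span `⨂_b` (binder-1's `span_tprod_of_span_eq_top`, restated below the `Binders` layer);
* §2 the printed torus on a pure tensor of `locFam` members: weight `∏_b χ_b(t_b) · polyExcess_b(t_b)`;
* §3 the Weil side at the W pin of record on the same pure tensor: scalar `η · χ_T · ∏_w dLetterAt` (`OmgInsTorus`);
* §4 the two scalars agree under `hμ` (`OmgInsLetters.eSigmaAt_archOf` place by place), hence the junction on pure tensors and,
  by linearity, on every `φ`: **`omgW_ins_eq_of_weight`** — E's family `homg` as a THEOREM modulo (J-μ).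

KERNEL only; nothing here is a claim of PerL/QW8.
-/

set_option autoImplicit false

noncomputable section

open NumberField NumberField.InfinitePlace
open scoped TensorProduct Classical ComplexConjugate
open MvPolynomial
open Literature.NumberTheory.Automorphic Literature.NumberTheory.Automorphic.UnitaryGroup Literature.NumberTheory.Weil1964
open Literature.RepresentationTheory.KonnoKonno2007 Literature.RepresentationTheory.KonnoKonno2007.RealDualPair
open Literature.NumberTheory.GelbartRogawski1991 Literature.NumberTheory.GelbartRogawski1991.UnitaryDualPair
open Literature.Analysis.SegalBargmann
open HodgeCM HodgeCM.Model HodgeCM.Adelic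
open HodgeCM.PerL34.Fock HodgeCM.PerL34.Fock.PrintDict
open NumberField.SeesawArchTorus

namespace HodgeCM.Model.HypCensus

/-! ## §1 Pure tensors of spanning families span the tensor product -/

/-- If `E b` spans `M b` for every `b`, the pure tensors with components in the `E b` span `⨂[ℂ] b, M b`
(binder-1's `HodgeCM.Model.span_tprod_of_span_eq_top`, `Binders/Real34CensusTAssembly`, restated here below the `Binders` layer). -/
theorem span_tprod_of_forall_span_eq_top {ιb : Type*} [Fintype ιb] [DecidableEq ιb] {M : ιb → Type*}
    [∀ b, AddCommGroup (M b)] [∀ b, Module ℂ (M b)] (E : ∀ b, Set (M b)) (hE : ∀ b, Submodule.span ℂ (E b) = ⊤) :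
    Submodule.span ℂ {x : ⨂[ℂ] b, M b | ∃ m : ∀ b, M b, (∀ b, m b ∈ E b) ∧ x = PiTensorProduct.tprod ℂ m} = ⊤ := by
  set N := Submodule.span ℂ {x : ⨂[ℂ] b, M b | ∃ m : ∀ b, M b, (∀ b, m b ∈ E b) ∧ x = PiTensorProduct.tprod ℂ m} with hN
  have key : ∀ s : Finset ιb, ∀ m : ∀ b, M b, (∀ b, b ∉ s → m b ∈ E b) → PiTensorProduct.tprod ℂ m ∈ N := by
    intro s
    induction s using Finset.induction_on with
    | empty => exact fun m hm => Submodule.subset_span ⟨m, fun b => hm b (Finset.notMem_empty b), rfl⟩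
    | @insert j s hj ih =>
      intro m hm
      have hle : Submodule.span ℂ (E j) ≤ N.comap ((PiTensorProduct.tprod ℂ : MultilinearMap ℂ M (⨂[ℂ] b, M b)).toLinearMap m j) := by
        refine Submodule.span_le.2 fun v hv => ?_
        change PiTensorProduct.tprod ℂ (Function.update m j v) ∈ N
        refine ih _ fun b hb => ?_
        by_cases hbj : b = j
        · subst hbj; rw [Function.update_self]; exact hv
        · rw [Function.update_of_ne hbj]; exact hm b (by rw [Finset.mem_insert, not_or]; exact ⟨hbj, hb⟩)
      have hmj : m j ∈ Submodule.span ℂ (E j) := by rw [hE j]; exact Submodule.mem_top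
      have := hle hmj
      rw [Submodule.mem_comap, MultilinearMap.toLinearMap_apply, Function.update_eq_self] at this
      exact this
  rw [eq_top_iff, ← PiTensorProduct.span_tprod_eq_top, Submodule.span_le]
  rintro _ ⟨m, rfl⟩
  exact key Finset.univ m fun b hb => absurd (Finset.mem_univ b) hb

/-! ## §2 The printed torus on a pure tensor of `locFam` members -/

section Printed

variable (RP : Type) [Fintype RP] [DecidableEq RP] (kind : RP → PlaceKind) (lam : RP → ℂ) (hlam : ∀ b, lam b ≠ 0)
  (vac : RP → (Circle × Circle →* Circle))

/-- `ω_T(t) (⊗_b x_{i_b}) = (∏_b χ_b(t_b) · polyExcess_b(t_b)) • ⊗_b x_{i_b}` for the printed eigenfamilies `locFam`. -/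
theorem ωT_tprod_locFam (i : ∀ b : RP, locIdx (kind b)) (t : (printPlaces RP kind lam hlam vac).Tg) :
    (printPlaces RP kind lam hlam vac).ωT t
        (PiTensorProduct.tprod ℂ fun b => locFam (lam b) (hlam b) (vac b) (kind b) (i b)) =
      (∏ b, (((printPlaces RP kind lam hlam vac).loc b).χ (t b) *
          polyExcess (kind b) (i b) (kindCoord (lam b) (hlam b) (vac b) (kind b) (t b)))) •
        PiTensorProduct.tprod ℂ fun b => locFam (lam b) (hlam b) (vac b) (kind b) (i b) := by
  unfold FockPlaces.ωT
  rw [PiTensorProduct.map_tprod]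
  have h : (fun b => ((printPlaces RP kind lam hlam vac).loc b).ω (t b) (locFam (lam b) (hlam b) (vac b) (kind b) (i b))) =
      fun b => (((printPlaces RP kind lam hlam vac).loc b).χ (t b) *
          polyExcess (kind b) (i b) (kindCoord (lam b) (hlam b) (vac b) (kind b) (t b))) •
        locFam (lam b) (hlam b) (vac b) (kind b) (i b) :=
    funext fun b => printLoc_ω_locFam (lam b) (hlam b) (vac b) (kind b) (i b) (t b)
  exact (congrArg (PiTensorProduct.tprod ℂ) h).trans ((PiTensorProduct.tprod ℂ).map_smul_univ _ _)

/-- the pure tensors of `locFam` members span the printed archimedean module. -/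
theorem span_tprod_locFam :
    Submodule.span ℂ {x : (printPlaces RP kind lam hlam vac).F |
      ∃ i : ∀ b : RP, locIdx (kind b), x = PiTensorProduct.tprod ℂ fun b => locFam (lam b) (hlam b) (vac b) (kind b) (i b)} = ⊤ := by
  have h := span_tprod_of_forall_span_eq_top (M := fun b => ((printPlaces RP kind lam hlam vac).loc b).M)
    (fun b => Set.range (locFam (lam b) (hlam b) (vac b) (kind b))) (fun b => locFam_span (lam b) (hlam b) (vac b) (kind b))
  rw [eq_top_iff, ← h, Submodule.span_le]
  rintro _ ⟨m, hm, rfl⟩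
  choose i hi using hm
  exact Submodule.subset_span ⟨i, congrArg (PiTensorProduct.tprod ℂ) (funext fun b => (hi b).symm)⟩

end Printed

/-! ## §3–§4 At the W pin of record: the junction on pure tensors and on every vector -/

section Pin

variable {L : CMField} {ι₁ : L →+* ℂ} (V : HermSpace3 L ι₁) (S : StubTree.SeesawDatum L)
variable
  (hGR : (cmSplittingDatum (L : Type) finProdFinEquiv (frameD V) (frameD_real V) (frameD_ne V) (dW S) (dW_real S) (dW_ne S)).CompatibleSplitting)
  (η : CMAdelic (L : Type) (frameD V) × CMAdelic (L : Type) (dW S) →* ℂˣ)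
  (hη : ∀ γU ∈ CMRat (L : Type) (frameD V), ∀ γ ∈ CMRat (L : Type) (dW S), η (γU, γ) = 1)
  (hηc : Continuous fun p => ((η p : ℂˣ) : ℂ))
  (τ : L →+* ℂ) (T : GL (Fin 3) ℂ)
  (hT : formCongr (starRingEnd ℂ) T (V.Hm.map τ) = Literature.Geometry.ComplexHyperbolic.BallModel.J)
variable (hW : (∀ j, 0 < (ι₁ ((dW S) j)).re) ∨ ∀ j, (ι₁ ((dW S) j)).re < 0)
variable (jD : InfinitePlace (L : Type) → HodgeCM.PerL34.Fock.EqVar → Fin 6) (m₁ m₂ : InfinitePlace (L : Type) → ℤ)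

/-- the printed places of the chosen census data (abbreviation for the statements below). -/
abbrev placesAt : FockPlaces :=
  printPlaces (InfinitePlace (L : Type))
    (kindOf (L : Type) (frameD V) (frameD_real V) (dW S) (dW_real S) ι₁ (datumAt V S jD (jIOf V S hW)))
    (lamOf (L : Type) (frameD V) (frameD_real V) (dW S) (dW_real S) ι₁ (datumAt V S jD (jIOf V S hW)))
    (lamOf_ne_zero (L : Type) (frameD V) (frameD_real V) (dW S) (dW_real S) ι₁ (datumAt V S jD (jIOf V S hW)))
    (pinnedVacs (kindOf (L : Type) (frameD V) (frameD_real V) (dW S) (dW_real S) ι₁ (datumAt V S jD (jIOf V S hW))) m₁ m₂)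

/-- the chart torus hom of the chosen census data (abbreviation). -/
abbrev pTH :=
  printedTorusHom (kindOf (L : Type) (frameD V) (frameD_real V) (dW S) (dW_real S) ι₁ (datumAt V S jD (jIOf V S hW)))
    (lamOf (L : Type) (frameD V) (frameD_real V) (dW S) (dW_real S) ι₁ (datumAt V S jD (jIOf V S hW)))
    (lamOf_ne_zero (L : Type) (frameD V) (frameD_real V) (dW S) (dW_real S) ι₁ (datumAt V S jD (jIOf V S hW)))
    (S.jT₁₂.toMonoidHom.comp (toAdeles (L : Type)))
    (pinnedVacs (kindOf (L : Type) (frameD V) (frameD_real V) (dW S) (dW_real S) ι₁ (datumAt V S jD (jIOf V S hW))) m₁ m₂)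

/-- the printed insertion of the chosen census data (abbreviation). -/
abbrev insAt (f : FinSB ↥(maximalRealSubfield L) (Fin 6)) :
    (placesAt V S hW jD m₁ m₂).F →ₗ[ℂ] ↥(piSchwartzBruhat ↥(maximalRealSubfield L) (Fin 6)) :=
  ins (L : Type) (frameD V) (frameD_real V) (frameD_ne V) (dW S) (dW_real S) (dW_ne S) ι₁ (datumAt V S jD (jIOf V S hW)) m₁ m₂ f

/-- the (J-μ) scalar of the pin at a printed torus point: `η(1,(diag u_t)_𝔸) · χ_T(u_t)`. -/
abbrev muScalar (t : (placesAt V S hW jD m₁ m₂).Tg) : ℂ :=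
  ((η (archProdHom (↥(maximalRealSubfield L)) (L : Type) (IsCMField.complexConj L) 3 2 (Matrix.diagonal (frameD V))
        (Matrix.diagonal (dW S))
        ((1 : UnitaryGroup.arch (↥(maximalRealSubfield L)) (L : Type) (IsCMField.complexConj L) 3 (Matrix.diagonal (frameD V))),
          archDiag (L : Type) (dW S) (archOf V S (datumAt V S jD (jIOf V S hW)) m₁ m₂ t))) : ℂˣ) : ℂ) *
    ((pinTorusChar V S hGR hW (archOf V S (datumAt V S jD (jIOf V S hW)) m₁ m₂ t) : Circle) : ℂ)

set_option maxHeartbeats 400000 in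
/-- **the Weil side on a pure tensor of `locFam` members, at the W pin of record**: scalar `η · χ_T(u_t) · ∏_w dLetterAt(u_t)`. -/
theorem omgW_ins_tprod_famOf_wmInputCM₂g
    (i : ∀ b : InfinitePlace (L : Type), locIdx (datumAt V S jD (jIOf V S hW) b).kind)
    (f : FinSB ↥(maximalRealSubfield L) (Fin 6)) (t : (placesAt V S hW jD m₁ m₂).Tg) :
    omgW (wmInputCM₂g V S hGR η hη hηc τ T hT)
        (printedTorusHom (kindOf (L : Type) (frameD V) (frameD_real V) (dW S) (dW_real S) ι₁ (datumAt V S jD (jIOf V S hW)))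
          (lamOf (L : Type) (frameD V) (frameD_real V) (dW S) (dW_real S) ι₁ (datumAt V S jD (jIOf V S hW)))
          (lamOf_ne_zero (L : Type) (frameD V) (frameD_real V) (dW S) (dW_real S) ι₁ (datumAt V S jD (jIOf V S hW)))
          (S.jT₁₂.toMonoidHom.comp (toAdeles (L : Type)))
          (pinnedVacs (kindOf (L : Type) (frameD V) (frameD_real V) (dW S) (dW_real S) ι₁ (datumAt V S jD (jIOf V S hW))) m₁ m₂) t)
        (ins (L : Type) (frameD V) (frameD_real V) (frameD_ne V) (dW S) (dW_real S) (dW_ne S) ι₁ (datumAt V S jD (jIOf V S hW)) m₁ m₂ f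
          (PiTensorProduct.tprod ℂ (famOf V S hW jD m₁ m₂ i))) =
      (muScalar V S hGR η hW jD m₁ m₂ t * ∏ w, dLetterAt V S hW jD i w (archOf V S (datumAt V S jD (jIOf V S hW)) m₁ m₂ t)) •
        ins (L : Type) (frameD V) (frameD_real V) (frameD_ne V) (dW S) (dW_real S) (dW_ne S) ι₁ (datumAt V S jD (jIOf V S hW)) m₁ m₂ f
          (PiTensorProduct.tprod ℂ (famOf V S hW jD m₁ m₂ i)) := by
  dsimp only [omgW, muScalar]
  rw [wmInputCM₂g_ρ_eq_of V S hGR η hη hηc τ T hT hW, printedTorusHom_apply]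
  exact (congrArg (fun p => cmPairRepTwist (L : Type) finProdFinEquiv (frameD V) (frameD_real V) (frameD_ne V) (dW S) (dW_real S)
      (dW_ne S) hGR η p (ins (L : Type) (frameD V) (frameD_real V) (frameD_ne V) (dW S) (dW_real S) (dW_ne S) ι₁
        (datumAt V S jD (jIOf V S hW)) m₁ m₂ f (PiTensorProduct.tprod ℂ (famOf V S hW jD m₁ m₂ i))))
      (pair_cmAdelicEquiv_jT₁₂_toAdeles V S _)).trans
    (cmPairRepTwist_torus_ins_tprod_of_eigen (L : Type) (frameD V) (frameD_real V) (frameD_ne V) (dW S) (dW_real S) (dW_ne S) hGR ι₁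
      (frameD_sign_ι₁' V) hW (frameD_sign_of_ne V)
      (fun τ' _ => signs_fin_two fun j => re_apply_ne_zero_of_complexConj_eq (L : Type) τ' (dW_real S j) (dW_ne S j)) η
      (datumAt V S jD (jIOf V S hW)) m₁ m₂ _ f (famOf V S hW jD m₁ m₂ i) (fun w => dLetterAt V S hW jD i w _)
      (fun w => linSubst_torusLetter_placePoly_famOf V S hW jD m₁ m₂ i w _))

/-- **the two scalars agree under (J-μ)**: `η · χ_T · ∏_w dLetterAt = ∏_b χ_b(t_b) · polyExcess_b(t_b)`. -/
theorem scalar_eq_of_weight (i : ∀ b : InfinitePlace (L : Type), locIdx (datumAt V S jD (jIOf V S hW) b).kind)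
    (t : (placesAt V S hW jD m₁ m₂).Tg)
    (hμt : muScalar V S hGR η hW jD m₁ m₂ t *
        dIotaAt (L : Type) (frameD V) (dW S) (dW_real S) ι₁ (archOf V S (datumAt V S jD (jIOf V S hW)) m₁ m₂ t) =
      (printPlacesW (InfinitePlace (L : Type))
        (kindOf (L : Type) (frameD V) (frameD_real V) (dW S) (dW_real S) ι₁ (datumAt V S jD (jIOf V S hW)))
        (lamOf (L : Type) (frameD V) (frameD_real V) (dW S) (dW_real S) ι₁ (datumAt V S jD (jIOf V S hW)))
        (lamOf_ne_zero (L : Type) (frameD V) (frameD_real V) (dW S) (dW_real S) ι₁ (datumAt V S jD (jIOf V S hW)))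
        (pinnedVacs (kindOf (L : Type) (frameD V) (frameD_real V) (dW S) (dW_real S) ι₁ (datumAt V S jD (jIOf V S hW))) m₁ m₂) t)⁻¹) :
    muScalar V S hGR η hW jD m₁ m₂ t * ∏ w, dLetterAt V S hW jD i w (archOf V S (datumAt V S jD (jIOf V S hW)) m₁ m₂ t) =
      ∏ b, (((placesAt V S hW jD m₁ m₂).loc b).χ (t b) *
        polyExcess (kindOf (L : Type) (frameD V) (frameD_real V) (dW S) (dW_real S) ι₁ (datumAt V S jD (jIOf V S hW)) b) (i b)
          (kindCoord _ _ _ (kindOf (L : Type) (frameD V) (frameD_real V) (dW S) (dW_real S) ι₁ (datumAt V S jD (jIOf V S hW)) b) (t b))) := by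
  -- split the letter eigenvalues: `∏_w dLetterAt = dIotaAt · ∏_b eSigmaAt`
  have hsplit : ∏ w, dLetterAt V S hW jD i w (archOf V S (datumAt V S jD (jIOf V S hW)) m₁ m₂ t) =
      dIotaAt (L : Type) (frameD V) (dW S) (dW_real S) ι₁ (archOf V S (datumAt V S jD (jIOf V S hW)) m₁ m₂ t) *
        ∏ b, eSigmaAt V S hW jD i b (archOf V S (datumAt V S jD (jIOf V S hW)) m₁ m₂ t) := by
    unfold dLetterAt
    rw [Finset.prod_mul_distrib, prod_dAt]
    congr 1
    exact Fintype.prod_equiv (cmPlacesEquiv (L : Type)).symm _ _ fun w => rfl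
  rw [hsplit, ← mul_assoc, hμt, printPlacesW_apply, inv_inv, printPlaces_χ, Finset.prod_mul_distrib]
  exact congrArg₂ (· * ·) rfl (Finset.prod_congr rfl fun b _ => eSigmaAt_archOf V S hW jD m₁ m₂ i t b)

set_option maxHeartbeats 400000 in
/-- **THE TORUS JUNCTION ON EVERY PRINTED VECTOR, from (J-μ)**: if `η(1,(diag u_t)_𝔸) · χ_T(u_t) · dIotaAt(u_t) = (w t)⁻¹` for
every printed torus point `t`, then `ω(ι_T t)(ins f φ) = ins f (ω_T(t) φ)` for EVERY `φ` — E's hypothesis family `homg` (row 18;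
rows 17/19 by the same token) for the orientation-aware census. -/
theorem omgW_ins_eq_of_weight
    (hμ : ∀ t : (placesAt V S hW jD m₁ m₂).Tg,
      muScalar V S hGR η hW jD m₁ m₂ t *
          dIotaAt (L : Type) (frameD V) (dW S) (dW_real S) ι₁ (archOf V S (datumAt V S jD (jIOf V S hW)) m₁ m₂ t) =
        (printPlacesW (InfinitePlace (L : Type))
          (kindOf (L : Type) (frameD V) (frameD_real V) (dW S) (dW_real S) ι₁ (datumAt V S jD (jIOf V S hW)))
          (lamOf (L : Type) (frameD V) (frameD_real V) (dW S) (dW_real S) ι₁ (datumAt V S jD (jIOf V S hW)))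
          (lamOf_ne_zero (L : Type) (frameD V) (frameD_real V) (dW S) (dW_real S) ι₁ (datumAt V S jD (jIOf V S hW)))
          (pinnedVacs (kindOf (L : Type) (frameD V) (frameD_real V) (dW S) (dW_real S) ι₁ (datumAt V S jD (jIOf V S hW))) m₁ m₂) t)⁻¹)
    (f : FinSB ↥(maximalRealSubfield L) (Fin 6)) (t : (placesAt V S hW jD m₁ m₂).Tg) (φ : (placesAt V S hW jD m₁ m₂).F) :
    omgW (wmInputCM₂g V S hGR η hη hηc τ T hT) (pTH V S hW jD m₁ m₂ t) (insAt V S hW jD m₁ m₂ f φ) =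
      insAt V S hW jD m₁ m₂ f ((placesAt V S hW jD m₁ m₂).ωT t φ) := by
  -- on the spanning pure tensors of `locFam` members
  have key : ∀ i : (∀ b : InfinitePlace (L : Type), locIdx (datumAt V S jD (jIOf V S hW) b).kind),
      omgW (wmInputCM₂g V S hGR η hη hηc τ T hT) (pTH V S hW jD m₁ m₂ t)
          (insAt V S hW jD m₁ m₂ f (PiTensorProduct.tprod ℂ (famOf V S hW jD m₁ m₂ i))) =
        insAt V S hW jD m₁ m₂ f ((placesAt V S hW jD m₁ m₂).ωT t (PiTensorProduct.tprod ℂ (famOf V S hW jD m₁ m₂ i))) := by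
    intro i
    rw [omgW_ins_tprod_famOf_wmInputCM₂g V S hGR η hη hηc τ T hT hW jD m₁ m₂ i f t,
      scalar_eq_of_weight V S hGR η hW jD m₁ m₂ i t (hμ t)]
    have hT : (placesAt V S hW jD m₁ m₂).ωT t (PiTensorProduct.tprod ℂ (famOf V S hW jD m₁ m₂ i)) =
        (∏ b, (((placesAt V S hW jD m₁ m₂).loc b).χ (t b) *
          polyExcess (kindOf (L : Type) (frameD V) (frameD_real V) (dW S) (dW_real S) ι₁ (datumAt V S jD (jIOf V S hW)) b) (i b)
            (kindCoord _ _ _ (kindOf (L : Type) (frameD V) (frameD_real V) (dW S) (dW_real S) ι₁ (datumAt V S jD (jIOf V S hW)) b) (t b)))) •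
          PiTensorProduct.tprod ℂ (famOf V S hW jD m₁ m₂ i) :=
      ωT_tprod_locFam (InfinitePlace (L : Type))
        (kindOf (L : Type) (frameD V) (frameD_real V) (dW S) (dW_real S) ι₁ (datumAt V S jD (jIOf V S hW)))
        (lamOf (L : Type) (frameD V) (frameD_real V) (dW S) (dW_real S) ι₁ (datumAt V S jD (jIOf V S hW)))
        (lamOf_ne_zero (L : Type) (frameD V) (frameD_real V) (dW S) (dW_real S) ι₁ (datumAt V S jD (jIOf V S hW)))
        (pinnedVacs (kindOf (L : Type) (frameD V) (frameD_real V) (dW S) (dW_real S) ι₁ (datumAt V S jD (jIOf V S hW))) m₁ m₂) i t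
    rw [hT]
    exact ((insAt V S hW jD m₁ m₂ f).map_smul _ _).symm
  -- both sides are linear in `φ`
  have hlin : ((wmInputCM₂g V S hGR η hη hηc τ T hT).ρ (1, (wmInputCM₂g V S hGR η hη hηc τ T hT).eW (pTH V S hW jD m₁ m₂ t))).val ∘ₗ
        insAt V S hW jD m₁ m₂ f =
      insAt V S hW jD m₁ m₂ f ∘ₗ (placesAt V S hW jD m₁ m₂).ωT t := by
    refine LinearMap.ext_on (span_tprod_locFam (InfinitePlace (L : Type)) _ _ _ _) ?_
    rintro _ ⟨i, rfl⟩
    exact key i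
  exact LinearMap.congr_fun hlin φ

end Pin

end HodgeCM.Model.HypCensus

end
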